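import Summits.KontsevichZagierPeriods.KontsevichZagierPeriods.Theorems.RootDecompRelativeModAbsoluteEvenCircleP6

/-! # `RootDecompRelativeModAbsoluteEvenCircleP7` — part 7/10 of the mechanical ≤400-line split of `evB_src3.lean` (sha256 9b9fc462830f2800…)
Source: decomp-kz lens-3 g14 EvenCircle.lean FINAL @ba0f3b57 §K0–§K12 (land/EvenCircleB @954ab641, lint-fixed, §K12 re-pointed at the landed CircleSplit names; critic CLEARED g7-2 l.1388: evenCircleCellClose_holds); --supports stmt-KontsevichZagierPeriods-30572.
Split by census-1 g10 `gen/splitlean.py`: scopes re-opened with their `open`/`variable`/`set_option` context; mathematics and declaration order unchanged. -/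

noncomputable section
open Set MeasureTheory
open Literature.NumberTheory.Transcendental Literature.ModelTheory.ExponentialFields
namespace Summit.KontsevichZagierPeriods.RootDecompRelativeModAbsolute.Rung30571.RegularisedLogLayer.CylLog.Leaf.G13

namespace AngleFold

open Set MeasureTheory in
open Literature.NumberTheory.Transcendental Literature.ModelTheory.ExponentialFields in
/-- a compact coordinate interval inside an order-convex `T` -/
private theorem isCompact_coordIcc (a b : ℝ) : IsCompact {x : Fin 1 → ℝ | a ≤ x 0 ∧ x 0 ≤ b} := by
  have : {x : Fin 1 → ℝ | a ≤ x 0 ∧ x 0 ≤ b} = bpt '' Icc a b := by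
    ext x
    constructor
    · intro hx; exact ⟨x 0, ⟨hx.1, hx.2⟩, bpt_apply_zero x⟩
    · rintro ⟨r, hr, rfl⟩; simpa using hr
  rw [this]
  exact isCompact_Icc.image continuous_bpt

open Filter Topology in
/-- **The bottom half-cell fold for even circle kernels**: `half_top_even` transported along `x ↦ -x`
(finite bottom end `α`, integrability on top segments). -/
theorem half_bot_even {T : Set (Fin 1 → ℝ)} (hT : IsSemialgebraic ℚ T) (hTo : IsOpen T) (hTc : OrdConv T)
    (hne : T.Nonempty) {α : ℝ} (hα : IsGLB (bpt ⁻¹' T) α) {l : ℕ} (nn : Fin l → ℕ) {p u : Fin l → (Fin 1 → ℝ) → ℝ}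
    (hp : ∀ j, IsSemialgebraicFunOn ℚ T (p j)) (hu : ∀ j, IsSemialgebraicFunOn ℚ T (u j))
    (hu0 : ∀ j, ∀ x ∈ T, 0 ≤ u j x) (hud : ∀ j, ∀ x ∈ T, DifferentiableAt ℝ (u j) x)
    (hsgn : ∀ j, (∀ x ∈ T, du (u j) x = 0) ∨ (∀ x ∈ T, du (u j) x < 0) ∨ (∀ x ∈ T, 0 < du (u j) x))
    (hone : ∀ j, (∀ x ∈ T, u j x ≤ 1) ∨ (∀ x ∈ T, 1 ≤ u j x))
    (A : Fin l → KZ.IntegralRep 2) (hAd : ∀ j, (A j).domain = KZlog.band T (fun _ => 0) (u j))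
    (hAi : ∀ j, EqOn (A j).integrand (fun z => p j (Fin.init z) * gk (nn j) (z (Fin.last 1))) (A j).domain)
    (hint : ∀ j, IntegrableOn (fun x => p j x * Gn (nn j) (u j x)) T)
    (hloc : ∀ j, ∀ x₁ ∈ T, IntegrableOn (p j) {x | x ∈ T ∧ x₁ 0 ≤ x 0})
    (A₀ : KZ.IntegralRep 1) (hA₀d : A₀.domain = T) {a₀ : (Fin 1 → ℝ) → ℝ} (hA₀i : EqOn A₀.integrand a₀ T)
    (hzero : ∀ x ∈ T, a₀ x + ∑ j, p j x * Qk (nn j) (u j x) = 0)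
    {S : ℕ} (f' : Fin S → Fin l → ℤ) (m : Fin S → ℚ) (q' : Fin S → (Fin 1 → ℝ) → ℝ)
    (hrel : ∀ s, ∀ x ∈ T, ∑ j, (f' s j : ℝ) * Real.arctan (u j x) = (m s : ℝ) * Real.pi)
    (hbud : ∀ x ∈ T, ∑ s, q' s x * (m s : ℝ) = 0)
    (hpq : ∀ j, ∀ x ∈ T, (-1) ^ (nn j) * p j x = ∑ s, q' s x * (f' s j : ℝ)) :
    KZ.of A₀ + ∑ j, KZ.of (A j) ∈ KZ.relations := by
  have hTm : MeasurableSet T := IsSemialgebraic.measurableSet_holds hT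
  choose A' hA'd hA'i hcl using fun j => reflect_rep_circ hT (nn j) (hp j) (hu j) (hu0 j) (A j) (hAd j) (hAi j) (hint j)
  obtain ⟨A₀', hA₀'d, hA₀'i, hcl₀⟩ := reflect_rep_base hT A₀ hA₀d hA₀i
  suffices h : KZ.of A₀' + ∑ j, KZ.of (A' j) ∈ KZ.relations by
    have h1 : cl A₀' + ∑ j, cl (A' j) = 0 := by
      have := (mk_eq_zero_iff).2 h
      rw [map_add, map_sum] at this
      exact this
    apply (mk_eq_zero_iff).1
    rw [map_add, map_sum]
    show cl A₀ + ∑ j, cl (A j) = 0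
    rw [hcl₀, Finset.sum_congr rfl fun j _ => hcl j]
    exact h1
  set T' : Set (Fin 1 → ℝ) := {x | -x ∈ T} with hT'def
  have hT's : IsSemialgebraic ℚ T' := isSemialgebraic_reflect hT
  have hTo' : IsOpen T' := hTo.preimage continuous_neg
  have hTc' : OrdConv T' := by
    intro x hx y hy r hxr hry
    have h := hTc (-y) hy (-x) hx (-r) (by simp only [Pi.neg_apply]; linarith) (by simp only [Pi.neg_apply]; linarith)
    show -bpt r ∈ T
    rw [show -bpt r = bpt (-r) from by funext i; simp [bpt]]
    exact h
  have hne' : T'.Nonempty := by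
    obtain ⟨x, hx⟩ := hne
    exact ⟨-x, show -(-x) ∈ T by rw [neg_neg]; exact hx⟩
  have hnegbpt : ∀ r : ℝ, -bpt r = bpt (-r) := fun r => by funext i; simp [bpt]
  have hβ' : IsLUB (bpt ⁻¹' T') (-α) := by
    constructor
    · intro r hr
      have h : bpt (-r) ∈ T := by rw [← hnegbpt]; exact hr
      have := hα.1 h
      linarith
    · intro b hb
      have h : -b ∈ lowerBounds (bpt ⁻¹' T) := fun t ht => by
        have h' : -t ∈ bpt ⁻¹' T' := by
          show -bpt (-t) ∈ T
          rw [hnegbpt, neg_neg]; exact ht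
        have := hb h'
        linarith
      have := hα.2 h
      linarith
  have hud' : ∀ j, ∀ x ∈ T', DifferentiableAt ℝ (fun y => u j (-y)) x :=
    fun j x hx => (hud j (-x) hx).comp x (differentiableAt_id.neg)
  have hdu' : ∀ j, ∀ x ∈ T', du (fun y => u j (-y)) x = -du (u j) (-x) := by
    intro j x hx
    have h : HasFDerivAt (fun y => u j (-y))
        ((fderiv ℝ (u j) (-x)).comp (-(ContinuousLinearMap.id ℝ (Fin 1 → ℝ)))) x :=
      (hud j (-x) hx).hasFDerivAt.comp x ((hasFDerivAt_id x).neg)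
    show fderiv ℝ (fun y => u j (-y)) x (Pi.single 0 1) = -(fderiv ℝ (u j) (-x) (Pi.single 0 1))
    rw [h.fderiv]
    simp
  have hsgn' : ∀ j, (∀ x ∈ T', du (fun y => u j (-y)) x = 0) ∨ (∀ x ∈ T', du (fun y => u j (-y)) x < 0) ∨
      (∀ x ∈ T', 0 < du (fun y => u j (-y)) x) := fun j =>
    (hsgn j).imp (fun h x hx => by rw [hdu' j x hx, h (-x) hx, neg_zero]) fun h' =>
      h'.symm.imp (fun h x hx => by rw [hdu' j x hx]; linarith [h (-x) hx])
        (fun h x hx => by rw [hdu' j x hx]; linarith [h (-x) hx])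
  have hone' : ∀ j, (∀ x ∈ T', u j (-x) ≤ 1) ∨ (∀ x ∈ T', 1 ≤ u j (-x)) := fun j =>
    (hone j).imp (fun h x hx => h (-x) hx) (fun h x hx => h (-x) hx)
  have hint' : ∀ j, IntegrableOn (fun x => p j (-x) * Gn (nn j) (u j (-x))) T' := fun j =>
    (integrableOn_reflect hTm (fun x => p j (-x) * Gn (nn j) (u j (-x)))).2
      (by simpa only [neg_neg] using hint j)
  have hloc' : ∀ j, ∀ x₁ ∈ T', IntegrableOn (fun x => p j (-x)) {x | x ∈ T' ∧ x 0 ≤ x₁ 0} := by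
    intro j x₁ hx₁
    have hSm : MeasurableSet {y : Fin 1 → ℝ | y ∈ T ∧ (-x₁) 0 ≤ y 0} :=
      hTm.inter (measurableSet_le measurable_const (measurable_pi_apply 0))
    have hS : {x | x ∈ T' ∧ x 0 ≤ x₁ 0} = {x | -x ∈ {y : Fin 1 → ℝ | y ∈ T ∧ (-x₁) 0 ≤ y 0}} := by
      ext x
      simp only [mem_setOf_eq, Pi.neg_apply, neg_le_neg_iff, hT'def]
    rw [hS]
    exact (integrableOn_reflect hSm (fun x => p j (-x))).2 (by simpa only [neg_neg] using hloc j (-x₁) hx₁)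
  exact half_top_even hT's hTo' hTc' hne' hβ' nn (fun j => sa_comp_neg (hp j)) (fun j => sa_comp_neg (hu j))
    (fun j x hx => hu0 j (-x) hx) hud' hsgn' hone' A' hA'd (fun j z _ => by rw [hA'i j]) hint' hloc'
    A₀' hA₀'d (a₀ := fun x => a₀ (-x)) (by rw [hA₀'i]; exact fun _ _ => rfl)
    (fun x hx => hzero (-x) hx) f' m
    (fun s x => q' s (-x)) (fun s x hx => hrel s (-x) hx) (fun x hx => hbud (-x) hx) (fun j x hx => hpq j (-x) hx)

/-! ### §K9 Localisation with a base rep, interval cells and the cell fold (mirror of AngleFold §E0/§F). -/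

/-- Auxiliary step `loc₀` (§K9): loc₀. [bookkeeping] -/
theorem loc₀ {n l N : ℕ} {σ : Set (Fin n → ℝ)} (u : Fin l → (Fin n → ℝ) → ℝ)
    (hu : ∀ j, IsSemialgebraicFunOn ℚ σ (u j))
    (A : Fin l → KZ.IntegralRep (n + 1)) (hAd : ∀ j, (A j).domain = KZlog.band σ (fun _ => 0) (u j))
    (A₀ : KZ.IntegralRep n) (hA₀d : A₀.domain = σ)
    (E : Fin N → Set (Fin n → ℝ)) (hEsa : ∀ e, IsSemialgebraic ℚ (E e)) (hEσ : ∀ e, E e ⊆ σ)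
    (hdisj : Pairwise (Function.onFun Disjoint E)) (hnull : volume (σ \ ⋃ e, E e) = 0)
    (hcell : ∀ e, ∀ (AE : Fin l → KZ.IntegralRep (n + 1)) (AE₀ : KZ.IntegralRep n),
      (∀ j, (AE j).domain = KZlog.band (E e) (fun _ => 0) (u j)) → (∀ j, (AE j).integrand = (A j).integrand) →
      AE₀.domain = E e → AE₀.integrand = A₀.integrand →
      KZ.of AE₀ + ∑ j, KZ.of (AE j) ∈ KZ.relations) :
    KZ.of A₀ + ∑ j, KZ.of (A j) ∈ KZ.relations := by
  have hB : ∀ j e, IsSemialgebraic ℚ (KZlog.band (E e) (fun _ => 0) (u j)) := fun j e =>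
    KZlog.isSemialgebraic_band (saConst_zero (hEsa e)) ((hu j).mono (hEσ e) (hEsa e))
  have hsub : ∀ j e, KZlog.band (E e) (fun _ => 0) (u j) ⊆ (A j).domain := fun j e z hz => by
    rw [hAd]
    exact ⟨hEσ e hz.1, hz.2⟩
  set AE : Fin l → Fin N → KZ.IntegralRep (n + 1) := fun j e =>
    (A j).restrict _ (hB j e) (hsub j e) with hAE
  have hAEd : ∀ j e, (AE j e).domain = KZlog.band (E e) (fun _ => 0) (u j) := fun _ _ => rfl
  have hsplit : ∀ j, KZ.of (A j) - ∑ e, KZ.of (AE j e) ∈ KZ.relations := by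
    intro j
    refine KZ.of_sub_sum_of_mem_relations Finset.univ (A j) (AE j) (fun e _ => ?_)
      (fun e _ _ _ => rfl) ?_ ?_
    · rw [hAEd, Set.sdiff_eq_empty.mpr (hsub j e)]
      exact measure_empty
    · refine measure_mono_null (fun z hz => ?_) (KZ.volume_setOf_init_mem_eq_zero hnull)
      have hz1 := hz.1
      rw [hAd] at hz1
      refine ⟨hz1.1, fun hU => hz.2 ?_⟩
      obtain ⟨e, he⟩ := mem_iUnion.1 hU
      exact mem_iUnion₂.2 ⟨e, Finset.mem_univ e, ⟨he, hz1.2⟩⟩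
    · intro e _ e' _ hne
      rw [hAEd, hAEd, KZ.band_inter_band_eq_empty (Set.disjoint_iff_inter_eq_empty.1 (hdisj hne))]
      exact measure_empty
  have hsub₀ : ∀ e, E e ⊆ A₀.domain := fun e => by rw [hA₀d]; exact hEσ e
  set AE₀ : Fin N → KZ.IntegralRep n := fun e => A₀.restrict _ (hEsa e) (hsub₀ e) with hAE₀
  have hAE₀d : ∀ e, (AE₀ e).domain = E e := fun _ => rfl
  have hsplit₀ : KZ.of A₀ - ∑ e, KZ.of (AE₀ e) ∈ KZ.relations := by
    refine KZ.of_sub_sum_of_mem_relations Finset.univ A₀ AE₀ (fun e _ => ?_) (fun e _ _ _ => rfl) ?_ ?_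
    · rw [hAE₀d, Set.sdiff_eq_empty.mpr (hsub₀ e)]
      exact measure_empty
    · refine measure_mono_null (fun z hz => ?_) hnull
      have hz1 := hz.1
      rw [hA₀d] at hz1
      refine ⟨hz1, fun hU => hz.2 ?_⟩
      obtain ⟨e, he⟩ := mem_iUnion.1 hU
      exact mem_iUnion₂.2 ⟨e, Finset.mem_univ e, he⟩
    · intro e _ e' _ hne
      rw [hAE₀d, hAE₀d, Set.disjoint_iff_inter_eq_empty.1 (hdisj hne)]
      exact measure_empty
  have hcellrel : ∀ e, KZ.of (AE₀ e) + ∑ j, KZ.of (AE j e) ∈ KZ.relations := fun e =>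
    hcell e (fun j => AE j e) (AE₀ e) (fun j => rfl) (fun j => rfl) rfl rfl
  have hc : ∑ e, ∑ j, KZ.of (AE j e) = ∑ j, ∑ e, KZ.of (AE j e) := Finset.sum_comm
  have eq : KZ.of A₀ + ∑ j, KZ.of (A j) = (KZ.of A₀ - ∑ e, KZ.of (AE₀ e)) +
      ∑ j, (KZ.of (A j) - ∑ e, KZ.of (AE j e)) + ∑ e, (KZ.of (AE₀ e) + ∑ j, KZ.of (AE j e)) := by
    rw [Finset.sum_sub_distrib, Finset.sum_add_distrib, hc]; abel
  rw [eq]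
  exact KZ.relations.add_mem (KZ.relations.add_mem hsplit₀ (AddSubgroup.sum_mem _ fun j _ => hsplit j))
    (AddSubgroup.sum_mem _ fun c _ => hcellrel c)

/-- Auxiliary step `isGLB_lo` (§K9): is GLB lo. [bookkeeping] -/
theorem isGLB_lo {T : Set (Fin 1 → ℝ)} {q α : ℝ} (hα : IsGLB (bpt ⁻¹' T) α) (hne : ∃ x ∈ T, x 0 < q) :
    IsGLB (bpt ⁻¹' {x | x ∈ T ∧ x 0 - q < 0}) α := by
  constructor
  · intro r hr
    exact hα.1 (show bpt r ∈ T from hr.1)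
  · intro b hb
    apply hα.2
    intro t ht
    have ht' : bpt t ∈ T := ht
    obtain ⟨x, hxT, hxq⟩ := hne
    by_cases htq : t < q
    · exact hb (show bpt t ∈ T ∧ bpt t 0 - q < 0 from ⟨ht', by rw [bpt_apply]; linarith⟩)
    · have hbx : b ≤ x 0 :=
        hb (show bpt (x 0) ∈ T ∧ bpt (x 0) 0 - q < 0 from ⟨by rw [bpt_apply_zero]; exact hxT, by rw [bpt_apply]; linarith⟩)
      push Not at htq
      linarith

/-- Auxiliary step `isLUB_hi` (§K9): is LUB hi. [bookkeeping] -/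
theorem isLUB_hi {T : Set (Fin 1 → ℝ)} {q β : ℝ} (hβ : IsLUB (bpt ⁻¹' T) β) (hne : ∃ x ∈ T, q < x 0) :
    IsLUB (bpt ⁻¹' {x | x ∈ T ∧ q - x 0 < 0}) β := by
  constructor
  · intro r hr
    exact hβ.1 (show bpt r ∈ T from hr.1)
  · intro b hb
    apply hβ.2
    intro t ht
    have ht' : bpt t ∈ T := ht
    obtain ⟨x, hxT, hxq⟩ := hne
    by_cases htq : q < t
    · exact hb (show bpt t ∈ T ∧ q - bpt t 0 < 0 from ⟨ht', by rw [bpt_apply]; linarith⟩)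
    · have hbx : x 0 ≤ b :=
        hb (show bpt (x 0) ∈ T ∧ q - bpt (x 0) 0 < 0 from ⟨by rw [bpt_apply_zero]; exact hxT, by rw [bpt_apply]; linarith⟩)
      push Not at htq
      linarith

/-- **Interval fold (even circle kernels).**  On a bounded open order-convex `ℚ`-sa `T ⊆ ℝ¹` with smooth edges of constant
derivative signs, each on one side of `1`, continuous coefficients, the base rep and the pointwise identity: cut at a rational
point and apply `half_bot_even` / `half_top_even`. -/
theorem interval_fold_even {T : Set (Fin 1 → ℝ)} (hT : IsSemialgebraic ℚ T) (hTo : IsOpen T) (hTc : OrdConv T)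
    (hbb : BddBelow (bpt ⁻¹' T)) (hba : BddAbove (bpt ⁻¹' T)) {l : ℕ} (nn : Fin l → ℕ) {p u : Fin l → (Fin 1 → ℝ) → ℝ}
    (hp : ∀ j, IsSemialgebraicFunOn ℚ T (p j)) (hu : ∀ j, IsSemialgebraicFunOn ℚ T (u j))
    (hu0 : ∀ j, ∀ x ∈ T, 0 ≤ u j x) (hud : ∀ j, ∀ x ∈ T, DifferentiableAt ℝ (u j) x)
    (hsgn : ∀ j, (∀ x ∈ T, du (u j) x = 0) ∨ (∀ x ∈ T, du (u j) x < 0) ∨ (∀ x ∈ T, 0 < du (u j) x))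
    (hone : ∀ j, (∀ x ∈ T, u j x ≤ 1) ∨ (∀ x ∈ T, 1 ≤ u j x))
    (hpc : ∀ j, ContinuousOn (p j) T)
    (A : Fin l → KZ.IntegralRep 2) (hAd : ∀ j, (A j).domain = KZlog.band T (fun _ => 0) (u j))
    (hAi : ∀ j, EqOn (A j).integrand (fun z => p j (Fin.init z) * gk (nn j) (z (Fin.last 1))) (A j).domain)
    (hint : ∀ j, IntegrableOn (fun x => p j x * Gn (nn j) (u j x)) T)
    (A₀ : KZ.IntegralRep 1) (hA₀d : A₀.domain = T) {a₀ : (Fin 1 → ℝ) → ℝ} (hA₀i : EqOn A₀.integrand a₀ T)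
    (hzero : ∀ x ∈ T, a₀ x + ∑ j, p j x * Qk (nn j) (u j x) = 0)
    {S : ℕ} (f' : Fin S → Fin l → ℤ) (m : Fin S → ℚ) (q' : Fin S → (Fin 1 → ℝ) → ℝ)
    (hrel : ∀ s, ∀ x ∈ T, ∑ j, (f' s j : ℝ) * Real.arctan (u j x) = (m s : ℝ) * Real.pi)
    (hbud : ∀ x ∈ T, ∑ s, q' s x * (m s : ℝ) = 0)
    (hpq : ∀ j, ∀ x ∈ T, (-1) ^ (nn j) * p j x = ∑ s, q' s x * (f' s j : ℝ)) :
    KZ.of A₀ + ∑ j, KZ.of (A j) ∈ KZ.relations := by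
  rcases T.eq_empty_or_nonempty with hTe | ⟨x₂, hx₂⟩
  · apply (mk_eq_zero_iff).1
    rw [map_add, map_sum]
    show cl A₀ + ∑ j, cl (A j) = 0
    rw [cl_eq_zero_of_eqOn_zero A₀ fun z hz => by rw [hA₀d, hTe] at hz; exact hz.elim, zero_add]
    exact Finset.sum_eq_zero fun j _ => cl_eq_zero_of_eqOn_zero (A j) fun z hz => by
      rw [hAd j, hTe] at hz; exact hz.1.elim
  have hα : IsGLB (bpt ⁻¹' T) (sInf (bpt ⁻¹' T)) := isGLB_csInf ⟨x₂ 0, mem_preimage_bpt hx₂⟩ hbb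
  have hβ : IsLUB (bpt ⁻¹' T) (sSup (bpt ⁻¹' T)) := isLUB_csSup ⟨x₂ 0, mem_preimage_bpt hx₂⟩ hba
  -- a rational cut point `q ∈ T`
  obtain ⟨q, hqT⟩ :=
    Rat.denseRange_cast.exists_mem_open (isOpen_preimage_bpt hTo) ⟨x₂ 0, mem_preimage_bpt hx₂⟩
  have hqT' : bpt (q : ℝ) ∈ T := hqT
  have hco : IsSemialgebraicFunOn ℚ T (fun x => x 0) :=
    Literature.NumberTheory.Transcendental.isSemialgebraicFunOn_apply hT 0
  have hqs : SaConst T (q : ℝ) := saConst_ratCast hT q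
  -- the two halves
  set Tlo : Set (Fin 1 → ℝ) := {x | x ∈ T ∧ x 0 - (q : ℝ) < 0} with hTlo
  set Thi : Set (Fin 1 → ℝ) := {x | x ∈ T ∧ (q : ℝ) - x 0 < 0} with hThi
  have hlo_sa : IsSemialgebraic ℚ Tlo := by
    have h : IsSemialgebraicFunOn ℚ T (fun x => x 0 - (q : ℝ)) := IsSemialgebraicFunOn.sub_holds hco hqs
    exact h.isSemialgebraic_sep_neg
  have hhi_sa : IsSemialgebraic ℚ Thi := by
    have h : IsSemialgebraicFunOn ℚ T (fun x => (q : ℝ) - x 0) := IsSemialgebraicFunOn.sub_holds hqs hco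
    exact h.isSemialgebraic_sep_neg
  have hlo_o : IsOpen Tlo :=
    hTo.inter (isOpen_lt ((continuous_apply 0).sub continuous_const) continuous_const)
  have hhi_o : IsOpen Thi :=
    hTo.inter (isOpen_lt (continuous_const.sub (continuous_apply 0)) continuous_const)
  have hlo_c : OrdConv Tlo := fun x hx y hy r hxr hry =>
    ⟨hTc x hx.1 y hy.1 r hxr hry, by simp only [bpt_apply]; linarith [hy.2]⟩
  have hhi_c : OrdConv Thi := fun x hx y hy r hxr hry =>
    ⟨hTc x hx.1 y hy.1 r hxr hry, by simp only [bpt_apply]; linarith [hx.2]⟩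
  have hlo_ne' : ∃ x ∈ T, x 0 < (q : ℝ) := by
    obtain ⟨y, hy, hlt⟩ := exists_mem_lt hTo hqT'
    exact ⟨y, hy, by simp only [bpt_apply] at hlt; linarith⟩
  have hhi_ne' : ∃ x ∈ T, (q : ℝ) < x 0 := by
    obtain ⟨y, hy, hlt⟩ := exists_mem_gt hTo hqT'
    exact ⟨y, hy, by simp only [bpt_apply] at hlt; linarith⟩
  have hlo_ne : Tlo.Nonempty := by
    obtain ⟨y, hy, hlt⟩ := hlo_ne'
    exact ⟨y, hy, by linarith⟩
  have hhi_ne : Thi.Nonempty := by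
    obtain ⟨y, hy, hlt⟩ := hhi_ne'
    exact ⟨y, hy, by linarith⟩
  have hloT : Tlo ⊆ T := fun x hx => hx.1
  have hhiT : Thi ⊆ T := fun x hx => hx.1
  have hαlo : IsGLB (bpt ⁻¹' Tlo) (sInf (bpt ⁻¹' T)) := isGLB_lo hα hlo_ne'
  have hβhi : IsLUB (bpt ⁻¹' Thi) (sSup (bpt ⁻¹' T)) := isLUB_hi hβ hhi_ne'
  -- restriction of the pointwise hypotheses to a subset
  have restr_sgn : ∀ {T' : Set (Fin 1 → ℝ)}, T' ⊆ T → ∀ j, (∀ x ∈ T', du (u j) x = 0) ∨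
      (∀ x ∈ T', du (u j) x < 0) ∨ (∀ x ∈ T', 0 < du (u j) x) := fun hs j =>
    (hsgn j).imp (fun h x hx => h x (hs hx)) fun h => h.imp (fun h x hx => h x (hs hx)) (fun h x hx => h x (hs hx))
  have restr_one : ∀ {T' : Set (Fin 1 → ℝ)}, T' ⊆ T → ∀ j, (∀ x ∈ T', u j x ≤ 1) ∨ (∀ x ∈ T', 1 ≤ u j x) :=
    fun hs j => (hone j).imp (fun h x hx => h x (hs hx)) (fun h x hx => h x (hs hx))
  -- local integrability of the coefficients on compact coordinate intervals inside `T`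
  have hKint : ∀ j (a b : ℝ), bpt a ∈ T → bpt b ∈ T → IntegrableOn (p j) {x : Fin 1 → ℝ | a ≤ x 0 ∧ x 0 ≤ b} := by
    intro j a b ha hb
    have hKT : {x : Fin 1 → ℝ | a ≤ x 0 ∧ x 0 ≤ b} ⊆ T := fun x hx => by
      rw [← bpt_apply_zero x]
      exact hTc (bpt a) ha (bpt b) hb (x 0) (by simpa using hx.1) (by simpa using hx.2)
    exact ((hpc j).mono hKT).integrableOn_compact (isCompact_coordIcc a b)
  refine loc₀ u hu A hAd A₀ hA₀d ![Tlo, Thi] (fun e => by fin_cases e; exacts [hlo_sa, hhi_sa])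
    (fun e => by fin_cases e; exacts [hloT, hhiT]) ?_ ?_ ?_
  · intro e e' hne
    fin_cases e <;> fin_cases e'
    · exact (hne rfl).elim
    · show Disjoint Tlo Thi
      exact Set.disjoint_left.2 fun x h1 h2 => by linarith [h1.2, h2.2]
    · show Disjoint Thi Tlo
      exact Set.disjoint_left.2 fun x h1 h2 => by linarith [h1.2, h2.2]
    · exact (hne rfl).elim
  · refine measure_mono_null (fun x hx => ?_) (KZ.volume_setOf_last_eq_zero (n := 0) (q : ℝ))
    obtain ⟨hxT, hxU⟩ := hx
    simp only [mem_iUnion, not_exists] at hxU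
    have h0 : x ∉ Tlo := hxU 0
    have h1 : x ∉ Thi := hxU 1
    show x 0 = q
    by_contra hne
    rcases lt_or_gt_of_ne hne with h | h
    · exact h0 ⟨hxT, by linarith⟩
    · exact h1 ⟨hxT, by linarith⟩
  · intro e AE AE₀ hAEd hAEi hAE₀d hAE₀i
    fin_cases e
    · -- the bottom half `Tlo`: its bottom end is the bad one
      have hAEd' : ∀ j, (AE j).domain = KZlog.band Tlo (fun _ => 0) (u j) := hAEd
      have hAEi' : ∀ j, EqOn (AE j).integrand (fun z => p j (Fin.init z) * gk (nn j) (z (Fin.last 1)))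
          (AE j).domain := fun j z hz => by
        rw [hAEi j]
        exact hAi j (by rw [hAd j]; rw [hAEd' j] at hz; exact ⟨hz.1.1, hz.2⟩)
      have hAE₀d' : AE₀.domain = Tlo := hAE₀d
      refine half_bot_even hlo_sa hlo_o hlo_c hlo_ne hαlo nn (fun j => (hp j).mono hloT hlo_sa)
        (fun j => (hu j).mono hloT hlo_sa) (fun j x hx => hu0 j x hx.1) (fun j x hx => hud j x hx.1)
        (restr_sgn hloT) (restr_one hloT) AE hAEd' hAEi' (fun j => (hint j).mono_set hloT) ?_
        AE₀ hAE₀d' (a₀ := a₀) (by rw [hAE₀i]; exact hA₀i.mono hloT) (fun x hx => hzero x hx.1) f' m q'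
        (fun s x hx => hrel s x hx.1) (fun x hx => hbud x hx.1) (fun j x hx => hpq j x hx.1)
      intro j x₁ hx₁
      refine (hKint j (x₁ 0) q (by rw [bpt_apply_zero]; exact hx₁.1) hqT').mono_set fun x hx => ⟨hx.2, ?_⟩
      linarith [hx.1.2]
    · -- the top half `Thi`: its top end is the bad one
      have hAEd' : ∀ j, (AE j).domain = KZlog.band Thi (fun _ => 0) (u j) := hAEd
      have hAEi' : ∀ j, EqOn (AE j).integrand (fun z => p j (Fin.init z) * gk (nn j) (z (Fin.last 1)))
          (AE j).domain := fun j z hz => by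
        rw [hAEi j]
        exact hAi j (by rw [hAd j]; rw [hAEd' j] at hz; exact ⟨hz.1.1, hz.2⟩)
      have hAE₀d' : AE₀.domain = Thi := hAE₀d
      refine half_top_even hhi_sa hhi_o hhi_c hhi_ne hβhi nn (fun j => (hp j).mono hhiT hhi_sa)
        (fun j => (hu j).mono hhiT hhi_sa) (fun j x hx => hu0 j x hx.1) (fun j x hx => hud j x hx.1)
        (restr_sgn hhiT) (restr_one hhiT) AE hAEd' hAEi' (fun j => (hint j).mono_set hhiT) ?_
        AE₀ hAE₀d' (a₀ := a₀) (by rw [hAE₀i]; exact hA₀i.mono hhiT) (fun x hx => hzero x hx.1) f' m q'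
        (fun s x hx => hrel s x hx.1) (fun x hx => hbud x hx.1) (fun j x hx => hpq j x hx.1)
      intro j x₁ hx₁
      refine (hKint j q (x₁ 0) hqT' (by rw [bpt_apply_zero]; exact hx₁.1)).mono_set fun x hx => ⟨?_, hx.2⟩
      linarith [hx.1.2]

end AngleFold
end Summit.KontsevichZagierPeriods.RootDecompRelativeModAbsolute.Rung30571.RegularisedLogLayer.CylLog.Leaf.G13
end
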